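import Mathlib
import Summits.Ventures.PercRepro2.Defs
import Summits.Ventures.PercRepro2.Graph
import Summits.Ventures.PercRepro2.OneColourSwitch
import Summits.Ventures.PercRepro2.RegionHubSign
import Summits.Ventures.PercRepro2.SideSwitch
import Summits.Ventures.PercRepro2.SideSwitchFibre
import Summits.Ventures.PercRepro2.SideSwitchClosed
import Summits.Ventures.PercRepro2.SideSwitchComps
import Summits.Ventures.PercRepro2.SideSwitchCompsFibre
import Summits.Ventures.PercRepro2.M9NoPocketDefs
import Summits.Ventures.PercRepro2.M9NoPocketSetDefs
import Summits.Ventures.PercRepro2.M9NoPocketSetWorld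
import Summits.Ventures.PercRepro2.M9NoPocketSetWorldD

/-!
# The multi-`d` class without pockets — legality of an assignment (blind cell PercRepro2,
p3 g20, 2026-08-27; `proofs/P3-CPNC.md` §17i (2))

The multi-`d` form of `M9NoPocketLegal`: an assignment of a representative is `Sep` and doubly
reached only inside `D` exactly when its coordinate vector is legal (`mem_DSubSet_assignX_iff`).
Own work; std axioms.
-/

namespace Summit.Ventures.PercRepro2

namespace NoPocketSet

open Finset Classical RegionHub OneColourSwitch SideSwitch NoPocket

variable {V : Type*} {E : Type*}

section Legal

variable [Fintype V] [DecidableEq V] [Fintype E] [DecidableEq E]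

variable {ends : E → Sym2 V}

/-- A legal assignment is `Sep` and doubly reached only inside `D`. -/
lemma mem_DSubSet_assignX_of_mem_L4 {p q r s : V} {D : Finset V} (hnp : NoPocketAt ends D r s)
    (hind : DIndep ends D) (hpD : p ∉ D) (hqD : q ∉ D) (hDr : ∀ d ∈ D, d ≠ r)
    (hDs : ∀ d ∈ D, d ≠ s) {ρ : Config E} (hρ : ρ ∈ RepD ends p q r s D)
    {x : Finset (Finset V) × Finset E} (hx : x ∈ L4 ends D r s ρ) :
    assignX ends x ρ ∈ DSubSet ends p q r s D := by
  obtain ⟨⟨hT, hF⟩, hL⟩ := mem_L4.1 hx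
  have hK := K2_assignX hnp hind hρ hT hF hDr hDs (fun d hd => (hL d hd).2)
  have hM := M2_assignX hnp hind hρ hT hF hDr hDs (fun d hd => (hL d hd).1)
  have hsep' := sep2_endsD_assignX hρ hT hF
  obtain ⟨⟨hpK, hqK⟩, ⟨hpM, hqM⟩⟩ := sep2_iff.1 hsep'
  have hDZ := DZero_endsD_assignX hρ hT hF
  rw [mem_DSubSet]
  constructor
  · rw [sep2_iff, hK, hM]
    refine ⟨⟨?_, ?_⟩, ⟨?_, ?_⟩⟩
    · rintro (h | ⟨h, _⟩)
      · exact hpK h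
      · exact hpD h
    · rintro (h | ⟨h, _⟩)
      · exact hqK h
      · exact hqD h
    · rintro (h | ⟨h, _⟩)
      · exact hpM h
      · exact hpD h
    · rintro (h | ⟨h, _⟩)
      · exact hqM h
      · exact hqD h
  · intro y hyr hys hyD hyK hyM
    rw [hK] at hyK
    rw [hM] at hyM
    rcases hyK with hyK | ⟨h, _⟩
    · rcases hyM with hyM | ⟨h, _⟩
      · exact hDZ y hyr hys hyK hyM
      · exact hyD h
    · exact hyD h

/-- A `B`-side block vertex of an assignment lies in the `W`-world of `G`. -/
lemma mem_M2_assignX_of_mem_unionT {p q r s : V} {D : Finset V} {ρ : Config E}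
    (hρ : ρ ∈ RepD ends p q r s D) {x : Finset (Finset V) × Finset E}
    (hT : x.1 ⊆ blocks ends D r s ρ) (hF : x.2 ⊆ Tset ends D r s) {y : V} (hy : y ∈ unionT x.1) :
    y ∈ M2 ends r s (assignX ends x ρ) := by
  refine M2_endsD_subset_M2 (D := D) _ ?_
  rw [M2_endsD_assignX hρ hT hF]
  exact Or.inr (Finset.mem_coe.2 hy)

/-- An `A`-side block vertex of an assignment lies in the `Y`-world of `G`. -/
lemma mem_K2_assignX_of_block_notMem {p q r s : V} {D : Finset V} {ρ : Config E}
    (hρ : ρ ∈ RepD ends p q r s D) {x : Finset (Finset V) × Finset E}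
    (hT : x.1 ⊆ blocks ends D r s ρ) (hF : x.2 ⊆ Tset ends D r s) {C : Finset V}
    (hC : C ∈ blocks ends D r s ρ) (hCx : C ∉ x.1) {y : V} (hy : y ∈ C) :
    y ∈ K2 ends r s (assignX ends x ρ) := by
  refine K2_endsD_subset_K2 (D := D) _ ?_
  rw [K2_endsD_assignX hρ hT hF]
  refine ⟨mem_K2_endsD_of_block hρ hC hy, ?_⟩
  intro hyT
  exact hCx (block_mem_of_mem_unionT hT hC hy (Finset.mem_coe.1 hyT))

/-- An assignment that is `Sep` and doubly reached only inside `D` is legal. -/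
lemma mem_L4_of_mem_DSubSet_assignX {p q r s : V} {D : Finset V} (hDr : ∀ d ∈ D, d ≠ r)
    (hDs : ∀ d ∈ D, d ≠ s) {ρ : Config E} (hρ : ρ ∈ RepD ends p q r s D)
    {x : Finset (Finset V) × Finset E} (hT : x.1 ⊆ blocks ends D r s ρ)
    (hF : x.2 ⊆ Tset ends D r s) (hω : assignX ends x ρ ∈ DSubSet ends p q r s D) :
    x ∈ L4 ends D r s ρ := by
  obtain ⟨_, hD⟩ := mem_DSubSet.1 hω
  rw [mem_L4]
  refine ⟨⟨hT, hF⟩, fun d hd => ⟨?_, ?_⟩⟩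
  · intro hsrc C hC hCx ⟨e, y, hy, hends, hρe⟩
    obtain ⟨hyr, hys, hyD⟩ := block_vertex_ne hρ hDr hDs hC hy
    have hval := assignX_block_edge hρ hDr hDs hT hF hC hy hd hends
    rw [if_neg hCx, hρe] at hval
    have hdM := d_mem_M2_of_srcW hρ hDr hDs hT hF hd hsrc
    have hyM : y ∈ M2 ends r s (assignX ends x ρ) := mem_M2_of_closed hdM hval hends
    exact hD y hyr hys hyD (mem_K2_assignX_of_block_notMem hρ hT hF hC hCx hy) hyM
  · intro hsrc C hCx ⟨e, y, hy, hends, hρe⟩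
    have hC : C ∈ blocks ends D r s ρ := hT hCx
    obtain ⟨hyr, hys, hyD⟩ := block_vertex_ne hρ hDr hDs hC hy
    have hval := assignX_block_edge hρ hDr hDs hT hF hC hy hd hends
    rw [if_pos hCx, hρe] at hval
    have hdK := d_mem_K2_of_srcY hρ hDr hDs hT hF hd hsrc
    have hyK : y ∈ K2 ends r s (assignX ends x ρ) := mem_K2_of_open hdK hval hends
    exact hD y hyr hys hyD hyK (mem_M2_assignX_of_mem_unionT hρ hT hF (mem_unionT.2 ⟨C, hCx, hy⟩))

/-- **Legality of an assignment**: the assignment of a coordinate vector is `Sep` and doubly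
reached only inside `D` iff the vector is legal. -/
theorem mem_DSubSet_assignX_iff {p q r s : V} {D : Finset V} (hnp : NoPocketAt ends D r s)
    (hind : DIndep ends D) (hpD : p ∉ D) (hqD : q ∉ D) (hDr : ∀ d ∈ D, d ≠ r)
    (hDs : ∀ d ∈ D, d ≠ s) {ρ : Config E} (hρ : ρ ∈ RepD ends p q r s D)
    {x : Finset (Finset V) × Finset E} (hT : x.1 ⊆ blocks ends D r s ρ)
    (hF : x.2 ⊆ Tset ends D r s) :
    assignX ends x ρ ∈ DSubSet ends p q r s D ↔ x ∈ L4 ends D r s ρ :=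
  ⟨mem_L4_of_mem_DSubSet_assignX hDr hDs hρ hT hF,
    mem_DSubSet_assignX_of_mem_L4 hnp hind hpD hqD hDr hDs hρ⟩

end Legal

end NoPocketSet

end Summit.Ventures.PercRepro2
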